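import Mathlib
import Summits.QuantumFields.QCD.Theses.PauliWegnerSea
import Literature.MathematicalPhysics.QuantumFieldTheory.QCDWickMinorMeasurability
import Literature.MathematicalPhysics.QuantumFieldTheory.QCDPhaseQuenchedPositivity

/-!
# Stub `stub_gramTransfer` of line `crossing-split-integrability` (skeleton r5)
(crux `Summit.QuantumFields.QCD.Theses.PauliWegnerSea.PhaseQuenchedFlavourDecay` =
`Summit.QuantumFields.QCD.Theses.WilsonMobilityGap.PhaseQuenchedFlavourDecay`, item stmt-QuantumFields-9151)

The MEASURE-THEORETIC TRANSFER of the r5 Gram reshape: given the deterministic Gram inequality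
`‖det G[I,J]‖² ≤ Re det((G Gᴴ)[I,I])` (first hypothesis, for every square complex matrix `G` and index
maps `I J : Fin r → Fin n`) and the Gram-moment bound `GramMoments` (second hypothesis: ONE exponent
`q > ½` and, for every `r`, an eventual, volume-uniform bound `C_r` on the phase-quenched `q`-th moments of
`Re det((G Gᴴ)[I,I])`, `G = (diracMatrix U mq)⁻¹` the full quark propagator, together with their
phase-quenched integrability), the line's a-priori bound `MinorMoments` follows with `ε := 2q − 1 > 0`
and the SAME constants `C_r`:

* pointwise in the gauge field, `‖det G[I,J]‖^{1+ε} = (‖det G[I,J]‖²)^q ≤ (Re det((G Gᴴ)[I,I]))^q`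
  (`Real.rpow_mul`, `Real.rpow_two`, `Real.rpow_le_rpow`, `q ≥ 0`);
* the Wick minor `U ↦ det G_U[I,J]` is measurable (`measurable_det_inv_diracMatrix`), so
  `‖det G[I,J]‖^{1+ε}` is phase-quenched integrable by domination (`Integrable.mono'`);
* `⟨·⟩₊` is the integral against `qcdLatticeMeasure` (`qcdPhaseQuenchedExpect_eq_integral_qcdLatticeMeasure`),
  and `integral_mono` transfers the bound `≤ C_r`.

The statement below is the REGISTERED stub signature (tree vocabulary only); the Gram inequality stays a
HYPOTHESIS here (it is the neighbouring stub `stub_gramInequality`).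
-/

noncomputable section

namespace Summit.QuantumFields.QCD.Cruxes.PhaseQuenchedFlavourDecay.CrossingSplitIntegrability

open scoped BigOperators
open MeasureTheory Filter
open Literature.MathematicalPhysics.QuantumFieldTheory Literature.MathematicalPhysics.QuantumLattice
  Literature.Probability.LatticeModels

/-- Pointwise transfer: `0 ≤ x`, `x² ≤ y`, `½ < q` give `x^{1+(2q−1)} = (x²)^q ≤ y^q`. -/
private theorem rpow_one_add_le_rpow_of_sq_le {x y q : ℝ} (hx : 0 ≤ x) (hxy : x ^ 2 ≤ y)
    (hq : 1 / 2 < q) : x ^ (1 + (2 * q - 1)) ≤ y ^ q := by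
  have h2 : (1 + (2 * q - 1) : ℝ) = 2 * q := by ring
  rw [h2, Real.rpow_mul hx, Real.rpow_two]
  exact Real.rpow_le_rpow (sq_nonneg x) hxy (by linarith)

/-- Registered stub `stub_gramTransfer` (skeleton r5) of line `crossing-split-integrability` for crux
stmt-QuantumFields-9151 — `GramInequality → ∀ Nf reg m, GramMoments → MinorMoments` with `ε = 2q − 1` and the
same constant `C_r` for every `r`: pointwise `‖minor‖^{1+ε} = (‖minor‖²)^q ≤ (Re det Gram)^q`, integrability by
domination, expectations by `⟨·⟩₊ = ∫ · d(qcdLatticeMeasure)` and monotonicity of the integral. -/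
theorem stub_gramTransfer :
    (∀ (n r : ℕ) (G : Matrix (Fin n) (Fin n) ℂ) (I J : Fin r → Fin n),
      ‖(Matrix.of fun a b : Fin r => G (I a) (J b)).det‖ ^ 2 ≤
        (Matrix.of fun a b : Fin r => (G * G.conjTranspose) (I a) (I b)).det.re) →
    ∀ (Nf : ℕ) (reg : QCDRegularisation Nf) (m : Fin Nf → ℝ),
      (∃ q : ℝ, 1 / 2 < q ∧ ∀ r : ℕ, ∃ C : ℝ, ∀ᶠ k in atTop, ∀ S : ℕ, reg.L k ≤ S →
        ∀ I : Fin r → QuarkVar Nf (2 * S + 1),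
          Integrable (fun U : GaugeConfig 4 (2 * S + 1) SU3 =>
              (Matrix.of fun a b : Fin r =>
                ((diracMatrix U fun fl => reg.mcrit k + reg.a k * m fl / reg.Zm k)⁻¹ *
                  ((diracMatrix U fun fl => reg.mcrit k + reg.a k * m fl / reg.Zm k)⁻¹).conjTranspose)
                  (quarkEquiv (I a)) (quarkEquiv (I b))).det.re ^ q)
              (qcdLatticeMeasure (2 * S + 1) (reg.β k) fun fl => reg.mcrit k + reg.a k * m fl / reg.Zm k) ∧
            qcdPhaseQuenchedExpect (reg.β k) (2 * S + 1) (fun fl => reg.mcrit k + reg.a k * m fl / reg.Zm k)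
                (fun U : GaugeConfig 4 (2 * S + 1) SU3 =>
                  (Matrix.of fun a b : Fin r =>
                    ((diracMatrix U fun fl => reg.mcrit k + reg.a k * m fl / reg.Zm k)⁻¹ *
                      ((diracMatrix U fun fl => reg.mcrit k + reg.a k * m fl / reg.Zm k)⁻¹).conjTranspose)
                      (quarkEquiv (I a)) (quarkEquiv (I b))).det.re ^ q) ≤ C) →
      (∃ ε : ℝ, 0 < ε ∧ ∀ r : ℕ, ∃ C : ℝ, ∀ᶠ k in atTop, ∀ S : ℕ, reg.L k ≤ S →
        ∀ I J : Fin r → QuarkVar Nf (2 * S + 1),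
          Integrable (fun U : GaugeConfig 4 (2 * S + 1) SU3 =>
              ‖(Matrix.of fun a b : Fin r => (diracMatrix U fun fl => reg.mcrit k + reg.a k * m fl / reg.Zm k)⁻¹
                (quarkEquiv (I a)) (quarkEquiv (J b))).det‖ ^ (1 + ε))
              (qcdLatticeMeasure (2 * S + 1) (reg.β k) fun fl => reg.mcrit k + reg.a k * m fl / reg.Zm k) ∧
            qcdPhaseQuenchedExpect (reg.β k) (2 * S + 1) (fun fl => reg.mcrit k + reg.a k * m fl / reg.Zm k)
                (fun U : GaugeConfig 4 (2 * S + 1) SU3 =>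
                  ‖(Matrix.of fun a b : Fin r => (diracMatrix U fun fl => reg.mcrit k + reg.a k * m fl / reg.Zm k)⁻¹
                    (quarkEquiv (I a)) (quarkEquiv (J b))).det‖ ^ (1 + ε)) ≤ C) := by
  intro hGI Nf reg m hGM
  obtain ⟨q, hq, hG⟩ := hGM
  refine ⟨2 * q - 1, by linarith, fun r => ?_⟩
  obtain ⟨C, hC⟩ := hG r
  refine ⟨C, ?_⟩
  filter_upwards [hC] with k hk S hS I J
  obtain ⟨hint, hexp⟩ := hk S hS I
  set mq : Fin Nf → ℝ := fun fl => reg.mcrit k + reg.a k * m fl / reg.Zm k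
  set φ : GaugeConfig 4 (2 * S + 1) SU3 → ℝ := fun U =>
    ‖(Matrix.of fun a b : Fin r => (diracMatrix U mq)⁻¹ (quarkEquiv (I a)) (quarkEquiv (J b))).det‖ ^
      (1 + (2 * q - 1))
  set g : GaugeConfig 4 (2 * S + 1) SU3 → ℝ := fun U =>
    (Matrix.of fun a b : Fin r => ((diracMatrix U mq)⁻¹ * ((diracMatrix U mq)⁻¹).conjTranspose)
      (quarkEquiv (I a)) (quarkEquiv (I b))).det.re ^ q
  -- pointwise: `0 ≤ φ ≤ g` from the Gram inequality
  have hφ0 : ∀ U, 0 ≤ φ U := fun U => Real.rpow_nonneg (norm_nonneg _) _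
  have hφg : ∀ U, φ U ≤ g U := fun U =>
    rpow_one_add_le_rpow_of_sq_le (norm_nonneg _)
      (hGI _ r (diracMatrix U mq)⁻¹ (fun a => quarkEquiv (I a)) (fun b => quarkEquiv (J b))) hq
  have hφn : ∀ U, ‖φ U‖ ≤ g U := fun U => by
    rw [Real.norm_eq_abs, abs_of_nonneg (hφ0 U)]; exact hφg U
  -- measurability of the Wick minor, hence of `φ`
  have hmeas : Measurable φ :=
    (measurable_det_inv_diracMatrix (S := 2 * S + 1) mq (fun a => quarkEquiv (I a))
      (fun b => quarkEquiv (J b))).norm.pow_const _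
  -- integrability by domination
  have hint' : Integrable φ (qcdLatticeMeasure (2 * S + 1) (reg.β k) mq) :=
    hint.mono' hmeas.aestronglyMeasurable (Eventually.of_forall hφn)
  refine ⟨hint', ?_⟩
  -- expectations: `⟨φ⟩₊ = ∫ φ ≤ ∫ g = ⟨g⟩₊ ≤ C`
  rw [qcdPhaseQuenchedExpect_eq_integral_qcdLatticeMeasure] at hexp ⊢
  exact (integral_mono hint' hint hφg).trans hexp

end Summit.QuantumFields.QCD.Cruxes.PhaseQuenchedFlavourDecay.CrossingSplitIntegrability

end
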